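import Summits.KontsevichZagierPeriods.KontsevichZagierPeriods.Theses.IsogenyCertificates
import Literature.NumberTheory.Transcendental.KZCalculus
import Literature.NumberTheory.EllipticCurves.RealLatticePeriod
import Summits.KontsevichZagierPeriods.KontsevichZagierPeriods.Theorems.IsogenyCertificatesRealPeriodSectorCompleteStubUnboundedReduction
import Summits.KontsevichZagierPeriods.KontsevichZagierPeriods.Theorems.IsogenyCertificatesRealPeriodSectorCompleteStubRealPeriodLattice
import Summits.KontsevichZagierPeriods.KontsevichZagierPeriods.Theorems.IsogenyCertificatesRealPeriodSectorCompleteStubUniformizedBranch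
import Summits.KontsevichZagierPeriods.KontsevichZagierPeriods.Theorems.IsogenyCertificatesRealPeriodSectorCompleteStubDividedIsogenyCurve
import Summits.KontsevichZagierPeriods.KontsevichZagierPeriods.Theorems.IsogenyCertificatesRealPeriodSectorCompleteStubContinuousBranchSemialgebraic
import Summits.KontsevichZagierPeriods.KontsevichZagierPeriods.Theorems.IsogenyCertificatesRealPeriodSectorCompleteStubBranchMove
import Literature.NumberTheory.Transcendental.SchneiderTwoWeierstrassCommensurable

/-!
# Crux `RealPeriodSectorComplete` (stmt-KontsevichZagierPeriods-5381) — line `period-ratio-branch-cov`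

Skeleton of the picked line (lead prover, re-authored from the planner's seven registered stub
signatures; the planner's `Lines/period-ratio-branch-cov.lean` is not readable from this seat).
Six of the seven stubs are LANDED as `--supports` files (imported above); the seventh, the
transcendence input `stub_realLatticeCommensurable` (Schneider 1937, two `℘`-functions), is proved
here from the Literature series `SchneiderTwoWeierstrass*.lean` landed for it. The file is sorry-free:
it CLOSES the crux.

Composition: for each curve reduce `[{P>0}, a/√P]` to the unbounded component
`[(e,∞), c/√P]` (`stub_unboundedReduction`); uniformise each curve by its real period lattice,
`℘_Λ(Ω/2) = e`, `value = c·Ω` (`stub_realPeriodLattice`), so value equality reads `Ω' = βΩ`,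
`β = c/c' ∈ ℚ`, and `Φ = ℘_{Λ'}(β ℘_Λ⁻¹)` is ONE strictly monotone branch `(e,∞) → (e',∞)`
with `Φ' = β √P'(Φ)/√P` (`stub_uniformizedBranch`; RESHAPED by the lead from the planner's
`stub_periodRatioBranch` + `stub_uniformizedBranch`, which asked for ODE uniqueness);
transcendence (`stub_realLatticeCommensurable`, Schneider 1937 two-`℘`) makes `Λ`, `β⁻¹Λ'`
commensurable, so the graph of `Φ` lies on a divided-isogeny curve `F = 0`, `F ∈ ℚ[x,y]` with
finite vertical fibres (`stub_dividedIsogenyCurve`); a continuous branch of such a curve is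
`ℚ`-semialgebraic (`stub_continuousBranchSemialgebraic`, CAD); hence rule 2) applies once
(`stub_branchMove`), and the two reductions close the chain.
-/

noncomputable section

open MeasureTheory Set Filter
open scoped PeriodPair
open Literature.ModelTheory.ExponentialFields (IsSemialgebraic isSemialgebraic_setOf_eval_eq_zero)
open Literature.NumberTheory.Transcendental
open Literature.NumberTheory.Transcendental.KZ

namespace Summit.KontsevichZagierPeriods.IsogenyCertificates.RealPeriodSectorCompleteLine

open Summit.KontsevichZagierPeriods.KontsevichZagierPeriods.Theses.IsogenyCertificates
  (RealPeriodSectorComplete)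
open Summit.KontsevichZagierPeriods.IsogenyCertificates.RealPeriodSectorCompleteStubs.UnboundedReduction
  (stub_unboundedReduction)
open Summit.KontsevichZagierPeriods.IsogenyCertificates.RealPeriodSectorCompleteStubs.RealPeriodLattice
  (stub_realPeriodLattice)
open Summit.KontsevichZagierPeriods.IsogenyCertificates.RealPeriodSectorCompleteStubs.UniformizedBranch
  (stub_uniformizedBranch)
open Summit.KontsevichZagierPeriods.IsogenyCertificates.RealPeriodSectorCompleteStubs.DividedIsogenyCurve
  (stub_dividedIsogenyCurve)
open Summit.KontsevichZagierPeriods.IsogenyCertificates.RealPeriodSectorCompleteStubs.ContinuousBranchSemialgebraic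
  (stub_continuousBranchSemialgebraic)
open Summit.KontsevichZagierPeriods.IsogenyCertificates.RealPeriodSectorCompleteStubs.BranchMove
  (stub_branchMove)

/-- STUB 4 (transcendence; Schneider 1937 for two `℘`'s — proved in the tree by the series
`Literature/NumberTheory/Transcendental/SchneiderTwoWeierstrass{Defs,Values,Analytic,Arith,Bounds,Proofs,Commensurable}.lean`,
main theorem `Schneider1937TwoP.schneider_twoWeierstrassP_commensurable`): two lattices with
algebraic invariants sharing a non-zero vector are commensurable.
[cite: Schneider1937, Satz] [cite: Baker1975, Ch. 6 Thm 6.1 and proof of Thm 6.3 p. 58] -/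
theorem stub_realLatticeCommensurable : ∀ (L₁ L₂ : PeriodPair), IsAlgebraic ℚ L₁.g₂ → IsAlgebraic ℚ L₁.g₃ → IsAlgebraic ℚ L₂.g₂ → IsAlgebraic ℚ L₂.g₃ → (∃ ℓ : ℂ, ℓ ≠ 0 ∧ ℓ ∈ L₁.lattice ∧ ℓ ∈ L₂.lattice) → ∃ m : ℕ, 0 < m ∧ ∀ z ∈ L₁.lattice, (m : ℂ) * z ∈ L₂.lattice :=
  fun L₁ L₂ h₂ h₃ h₂' h₃' hℓ =>
    Literature.NumberTheory.Transcendental.Schneider1937TwoP.schneider_twoWeierstrassP_commensurable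
      L₁ L₂ h₂ h₃ h₂' h₃' hℓ

/-- **The line closes the crux**: composition of the seven stubs. -/
theorem RealPeriodSectorComplete_of : RealPeriodSectorComplete := by
  intro A B A' B' hΔ hΔ' a b ha hb r r' hd hi hd' hi' hv
  -- reduce both sides to the unbounded components
  obtain ⟨e, c, r₁, he, hpos, hc, hd₁, hi₁, hE⟩ := stub_unboundedReduction A B hΔ a ha r hd hi
  obtain ⟨e', c', r₁', he', hpos', hc', hd₁', hi₁', hE'⟩ :=
    stub_unboundedReduction A' B' hΔ' b hb r' hd' hi'
  -- value equality transfers along the (sound) reductions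
  have hv₁ : r₁.value = r₁'.value := by
    rw [← Equivalent.value_eq_holds hE, ← Equivalent.value_eq_holds hE', hv]
  -- the two real period lattices, their largest roots and real periods
  obtain ⟨L, hL, hg₂, hg₃, heL, hval⟩ := stub_realPeriodLattice A B hΔ e he hpos c hc r₁ hd₁ hi₁
  obtain ⟨L', hL', hg₂', hg₃', heL', hval'⟩ :=
    stub_realPeriodLattice A' B' hΔ' e' he' hpos' c' hc' r₁' hd₁' hi₁'
  set β : ℚ := c / c' with hβ_def
  have hβ : 0 < β := div_pos hc hc'
  have hcc' : c = β * c' := by rw [hβ_def, div_mul_cancel₀ c hc'.ne']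
  have hper : L'.minRealPeriod = (β : ℝ) * L.minRealPeriod := by
    have h1 : (c : ℝ) * L.minRealPeriod = (c' : ℝ) * L'.minRealPeriod := by rw [← hval, ← hval', hv₁]
    have hc'0 : (c' : ℝ) ≠ 0 := by exact_mod_cast hc'.ne'
    rw [hβ_def]
    push_cast
    field_simp
    linarith
  -- the branch `Φ = ℘_{Λ'} ∘ (β ·) ∘ ℘_Λ⁻¹`
  obtain ⟨Φ, hmono, himg, hderiv, hbranch⟩ := stub_uniformizedBranch A B A' B' L L' hL hL' hg₂ hg₃
    hg₂' hg₃' β hβ hper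
  rw [heL] at hmono himg hderiv hbranch
  rw [heL'] at himg
  have hcont : ContinuousOn Φ (Ioi e) := fun x hx =>
    (hderiv x hx).continuousAt.continuousWithinAt
  -- the divided-isogeny curve through the graph (transcendence enters here)
  obtain ⟨F, hfin, hF⟩ := stub_dividedIsogenyCurve stub_realLatticeCommensurable A B A' B' e β hβ
    Φ L L' hL hL' hg₂ hg₃ hg₂' hg₃' hper hbranch hcont
  -- the graph of the branch is semialgebraic
  have hdomSA : IsSemialgebraic ℚ {p : Fin 1 → ℝ | e < p 0} := by
    have h := r₁.isSemialgebraic_domain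
    rwa [hd₁] at h
  have hZ : IsSemialgebraic ℚ {p : Fin 2 → ℝ | MvPolynomial.aeval p F = 0} :=
    isSemialgebraic_setOf_eval_eq_zero (R := ℝ) F
  have hgraph : IsSemialgebraic ℚ {p : Fin 2 → ℝ | e < p 0 ∧ p 1 = Φ (p 0)} :=
    stub_continuousBranchSemialgebraic e Φ {p : Fin 2 → ℝ | MvPolynomial.aeval p F = 0} hdomSA hZ
      (fun x hx => hfin x hx) hcont (fun x hx => hF x hx)
  -- one change of variables
  have hmove := stub_branchMove A B A' B' e e' hpos hpos' β c c' hβ hcc' Φ hmono himg hderiv hgraph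
    r₁ r₁' hd₁ hi₁ hd₁' hi₁'
  have h₁₁' : Equivalent r₁ r₁' := changeOfVariablesRel_subset_relations hmove
  exact (hE.trans h₁₁').trans hE'.symm

end Summit.KontsevichZagierPeriods.IsogenyCertificates.RealPeriodSectorCompleteLine

end
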